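import Literature.Probability.Percolation.QuadCrossingSquareModel
import Literature.Probability.Percolation.OpenPathAnnulusCrossing
import Literature.Probability.LatticeModels.MeshDomainBulk
import Literature.Probability.RandomPlanarGeometry.MarkedDomainCorners
import HarnessLib

/-!
# Crux `ClusterSetConnected`, line `registered` — square-model geometry for `stub_sandwichLowerOfWalks`

The dictionary between a conformal rectangle `R` with a square model `Φ : ℂ ≃ₜ ℂ`
(`IsSquareModel R Φ`: `Φ` maps the model square `(-1,1)²` onto `R.carrier` and side `k` onto
`R.arc k`) and the model coordinates `Φ⁻¹`: membership in the domain, its closure and its four arcs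
read in the model; positive separation of the "low band"
`Φ([-1+s/2, 1-s/2] × [-1, -1/2])` from the arcs other than arc `0` (and symmetrically for arc `2`);
and the resulting membership criterion for G02's discrete arcs `discreteArc`.
-/

noncomputable section

open Set Metric
open Literature.Probability.Percolation Literature.Probability.LatticeModels
open Literature.Probability.RandomPlanarGeometry

namespace Summit.CriticalPhenomena.CardyFormulaZ2.Theorems.ClusterSetConnected

namespace SquareModelDict

variable {R : ConformalRectangle} {Φ : ℂ ≃ₜ ℂ}

/-- The domain read in the model: `z ∈ Ω ↔ Φ⁻¹ z ∈ (-1,1)²`. -/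
theorem mem_carrier_iff (h : IsSquareModel R Φ) {z : ℂ} :
    z ∈ R.carrier ↔ (Φ.symm z).re ∈ Ioo (-1 : ℝ) 1 ∧ (Φ.symm z).im ∈ Ioo (-1 : ℝ) 1 := by
  rw [← h.image_carrier, unitSquareQuad_carrier, ← Φ.preimage_symm, mem_preimage,
    Complex.mem_reProdIm]

/-- The closed domain read in the model: `z ∈ Ω̄ ↔ Φ⁻¹ z ∈ [-1,1]²`. -/
theorem mem_closure_iff (h : IsSquareModel R Φ) {z : ℂ} :
    z ∈ closure R.carrier ↔ (Φ.symm z).re ∈ Icc (-1 : ℝ) 1 ∧ (Φ.symm z).im ∈ Icc (-1 : ℝ) 1 := by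
  rw [← h.image_Icc, ← Φ.preimage_symm, mem_preimage, Complex.mem_reProdIm]

/-- Arc `0` read in the model: the bottom side. -/
theorem mem_arc_zero_iff (h : IsSquareModel R Φ) {z : ℂ} :
    z ∈ R.arc 0 ↔ (Φ.symm z).im = -1 ∧ (Φ.symm z).re ∈ Icc (-1 : ℝ) 1 := by
  rw [← h.image_arc 0, ← Φ.preimage_symm, mem_preimage, SquareModel.mem_arc_zero]

/-- Arc `1` read in the model: the right side. -/
theorem mem_arc_one_iff (h : IsSquareModel R Φ) {z : ℂ} :
    z ∈ R.arc 1 ↔ (Φ.symm z).re = 1 ∧ (Φ.symm z).im ∈ Icc (-1 : ℝ) 1 := by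
  rw [← h.image_arc 1, ← Φ.preimage_symm, mem_preimage, SquareModel.mem_arc_one]

/-- Arc `2` read in the model: the top side. -/
theorem mem_arc_two_iff (h : IsSquareModel R Φ) {z : ℂ} :
    z ∈ R.arc 2 ↔ (Φ.symm z).im = 1 ∧ (Φ.symm z).re ∈ Icc (-1 : ℝ) 1 := by
  rw [← h.image_arc 2, ← Φ.preimage_symm, mem_preimage, SquareModel.mem_arc_two]

/-- Arc `3` read in the model: the left side. -/
theorem mem_arc_three_iff (h : IsSquareModel R Φ) {z : ℂ} :
    z ∈ R.arc 3 ↔ (Φ.symm z).re = -1 ∧ (Φ.symm z).im ∈ Icc (-1 : ℝ) 1 := by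
  rw [← h.image_arc 3, ← Φ.preimage_symm, mem_preimage, SquareModel.mem_arc_three]

/-- The frontier of the domain is the union of the four arcs. -/
theorem frontier_subset_arcs (R : ConformalRectangle) :
    frontier R.carrier ⊆ ((R.arc 0 ∪ R.arc 1) ∪ R.arc 2) ∪ R.arc 3 := by
  intro z hz
  rw [← (R.iUnion_arc_holds : ⋃ i, R.arc i = frontier R.carrier), mem_iUnion] at hz
  obtain ⟨i, hi⟩ := hz
  fin_cases i
  · exact Or.inl (Or.inl (Or.inl hi))
  · exact Or.inl (Or.inl (Or.inr hi))
  · exact Or.inl (Or.inr hi)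
  · exact Or.inr hi

/-- `pt 2` is a frontier point off arc `0` (so `frontier Ω \ arc 0` is nonempty). -/
theorem pt_two_mem_diff_arc_zero (R : ConformalRectangle) : R.pt 2 ∈ frontier R.carrier \ R.arc 0 := by
  refine ⟨R.pt_mem_frontier 2, fun h => ?_⟩
  rcases (R.pt_mem_arc_iff).1 h with h | h <;> exact absurd h (by decide)

/-- `pt 0` is a frontier point off arc `2` (so `frontier Ω \ arc 2` is nonempty). -/
theorem pt_zero_mem_diff_arc_two (R : ConformalRectangle) : R.pt 0 ∈ frontier R.carrier \ R.arc 2 := by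
  refine ⟨R.pt_mem_frontier 0, fun h => ?_⟩
  rcases (R.pt_mem_arc_iff).1 h with h | h <;> exact absurd h (by decide)

end SquareModelDict

section Separation

variable {R : ConformalRectangle} {Φ : ℂ ≃ₜ ℂ}

/-- **The low band is at positive distance from the arcs other than arc `0`.** For a square model
`Φ` of `R` and `0 < s`, points `z` with `Φ⁻¹ z ∈ [-1+s/2, 1-s/2] × [-1, -1/2]` are at `infDist`
more than some `ρ > 0` from `frontier Ω \ arc 0`. -/
theorem exists_sep_low (h : IsSquareModel R Φ) {s : ℝ} (hs : 0 < s) :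
    ∃ ρ > (0 : ℝ), ∀ z : ℂ, (Φ.symm z).re ∈ Icc (-1 + s / 2) (1 - s / 2) →
      (Φ.symm z).im ∈ Icc (-1 : ℝ) (-1 / 2) → ρ < infDist z (frontier R.carrier \ R.arc 0) := by
  -- the compact band and the closed union of the other three arcs
  have hC : IsCompact (Φ '' (Icc (-1 + s / 2) (1 - s / 2) ×ℂ Icc (-1 : ℝ) (-1 / 2))) :=
    (isCompact_Icc.reProdIm isCompact_Icc).image Φ.continuous
  have hF : IsClosed ((R.arc 1 ∪ R.arc 2) ∪ R.arc 3) :=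
    ((R.isClosed_arc 1).union (R.isClosed_arc 2)).union (R.isClosed_arc 3)
  have hFne : ((R.arc 1 ∪ R.arc 2) ∪ R.arc 3).Nonempty := ⟨R.pt 2, Or.inl (Or.inr (R.pt_mem_arc_self 2))⟩
  have hdisj : Disjoint (Φ '' (Icc (-1 + s / 2) (1 - s / 2) ×ℂ Icc (-1 : ℝ) (-1 / 2)))
      ((R.arc 1 ∪ R.arc 2) ∪ R.arc 3) := by
    rw [Set.disjoint_left]
    rintro _ ⟨p, hp, rfl⟩ hz
    rw [Complex.mem_reProdIm, mem_Icc, mem_Icc] at hp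
    rcases hz with (hz | hz) | hz
    · have h1 := ((SquareModelDict.mem_arc_one_iff h).1 hz).1
      rw [Homeomorph.symm_apply_apply] at h1; linarith [hp.1.2]
    · have h2 := ((SquareModelDict.mem_arc_two_iff h).1 hz).1
      rw [Homeomorph.symm_apply_apply] at h2; linarith [hp.2.2]
    · have h3 := ((SquareModelDict.mem_arc_three_iff h).1 hz).1
      rw [Homeomorph.symm_apply_apply] at h3; linarith [hp.1.1]
  obtain ⟨ρ, hρ, hsep⟩ := exists_pos_forall_lt_infDist hC hF hdisj hFne
  refine ⟨ρ, hρ, fun z hre him => ?_⟩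
  have hzC : z ∈ Φ '' (Icc (-1 + s / 2) (1 - s / 2) ×ℂ Icc (-1 : ℝ) (-1 / 2)) :=
    ⟨Φ.symm z, Complex.mem_reProdIm.2 ⟨hre, him⟩, Φ.apply_symm_apply z⟩
  -- `frontier Ω \ arc 0` is a nonempty subset of the three other arcs
  have hsub : frontier R.carrier \ R.arc 0 ⊆ (R.arc 1 ∪ R.arc 2) ∪ R.arc 3 := by
    rintro w ⟨hw, hw0⟩
    rcases SquareModelDict.frontier_subset_arcs R hw with ((h0 | h1) | h2) | h3
    · exact absurd h0 hw0
    · exact Or.inl (Or.inl h1)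
    · exact Or.inl (Or.inr h2)
    · exact Or.inr h3
  exact (hsep z hzC).trans_le
    (infDist_le_infDist_of_subset hsub ⟨R.pt 2, SquareModelDict.pt_two_mem_diff_arc_zero R⟩)

/-- **The high band is at positive distance from the arcs other than arc `2`.** -/
theorem exists_sep_high (h : IsSquareModel R Φ) {s : ℝ} (hs : 0 < s) :
    ∃ ρ > (0 : ℝ), ∀ z : ℂ, (Φ.symm z).re ∈ Icc (-1 + s / 2) (1 - s / 2) →
      (Φ.symm z).im ∈ Icc (1 / 2 : ℝ) 1 → ρ < infDist z (frontier R.carrier \ R.arc 2) := by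
  have hC : IsCompact (Φ '' (Icc (-1 + s / 2) (1 - s / 2) ×ℂ Icc (1 / 2 : ℝ) 1)) :=
    (isCompact_Icc.reProdIm isCompact_Icc).image Φ.continuous
  have hF : IsClosed ((R.arc 0 ∪ R.arc 1) ∪ R.arc 3) :=
    ((R.isClosed_arc 0).union (R.isClosed_arc 1)).union (R.isClosed_arc 3)
  have hFne : ((R.arc 0 ∪ R.arc 1) ∪ R.arc 3).Nonempty := ⟨R.pt 0, Or.inl (Or.inl (R.pt_mem_arc_self 0))⟩
  have hdisj : Disjoint (Φ '' (Icc (-1 + s / 2) (1 - s / 2) ×ℂ Icc (1 / 2 : ℝ) 1))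
      ((R.arc 0 ∪ R.arc 1) ∪ R.arc 3) := by
    rw [Set.disjoint_left]
    rintro _ ⟨p, hp, rfl⟩ hz
    rw [Complex.mem_reProdIm, mem_Icc, mem_Icc] at hp
    rcases hz with (hz | hz) | hz
    · have h0 := ((SquareModelDict.mem_arc_zero_iff h).1 hz).1
      rw [Homeomorph.symm_apply_apply] at h0; linarith [hp.2.1]
    · have h1 := ((SquareModelDict.mem_arc_one_iff h).1 hz).1
      rw [Homeomorph.symm_apply_apply] at h1; linarith [hp.1.2]
    · have h3 := ((SquareModelDict.mem_arc_three_iff h).1 hz).1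
      rw [Homeomorph.symm_apply_apply] at h3; linarith [hp.1.1]
  obtain ⟨ρ, hρ, hsep⟩ := exists_pos_forall_lt_infDist hC hF hdisj hFne
  refine ⟨ρ, hρ, fun z hre him => ?_⟩
  have hzC : z ∈ Φ '' (Icc (-1 + s / 2) (1 - s / 2) ×ℂ Icc (1 / 2 : ℝ) 1) :=
    ⟨Φ.symm z, Complex.mem_reProdIm.2 ⟨hre, him⟩, Φ.apply_symm_apply z⟩
  have hsub : frontier R.carrier \ R.arc 2 ⊆ (R.arc 0 ∪ R.arc 1) ∪ R.arc 3 := by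
    rintro w ⟨hw, hw2⟩
    rcases SquareModelDict.frontier_subset_arcs R hw with ((h0 | h1) | h2) | h3
    · exact Or.inl (Or.inl h0)
    · exact Or.inl (Or.inr h1)
    · exact absurd h2 hw2
    · exact Or.inr h3
  exact (hsep z hzC).trans_le
    (infDist_le_infDist_of_subset hsub ⟨R.pt 0, SquareModelDict.pt_zero_mem_diff_arc_two R⟩)

end Separation

section DiscreteArcs

variable {R : ConformalRectangle} {Φ : ℂ ≃ₜ ℂ}

/-- **Crossing the bottom side along a segment.** If `Φ⁻¹` has imaginary part `> -1` at `u` and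
`≤ -1` at `z₀`, then some point of the segment `[u, z₀]` has model height exactly `-1`. -/
theorem exists_im_eq_of_le {u z₀ : ℂ} {c : ℝ} (hu : c < (Φ.symm u).im) (hz₀ : (Φ.symm z₀).im ≤ c) :
    ∃ z ∈ segment ℝ u z₀, (Φ.symm z).im = c := by
  have hpc : IsPreconnected (segment ℝ u z₀) := (convex_segment u z₀).isPreconnected
  have hcont : ContinuousOn (fun z => (Φ.symm z).im) (segment ℝ u z₀) :=
    (Complex.continuous_im.comp Φ.symm.continuous).continuousOn
  have hmem : c ∈ Icc ((fun z => (Φ.symm z).im) z₀) ((fun z => (Φ.symm z).im) u) := ⟨hz₀, hu.le⟩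
  obtain ⟨z, hz, hzc⟩ := hpc.intermediate_value (right_mem_segment ℝ u z₀) (left_mem_segment ℝ u z₀)
    hcont hmem
  exact ⟨z, hz, hzc⟩

/-- **Crossing the top side along a segment.** -/
theorem exists_im_eq_of_ge {u z₀ : ℂ} {c : ℝ} (hu : (Φ.symm u).im < c) (hz₀ : c ≤ (Φ.symm z₀).im) :
    ∃ z ∈ segment ℝ u z₀, (Φ.symm z).im = c := by
  have hpc : IsPreconnected (segment ℝ u z₀) := (convex_segment u z₀).isPreconnected
  have hcont : ContinuousOn (fun z => (Φ.symm z).im) (segment ℝ u z₀) :=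
    (Complex.continuous_im.comp Φ.symm.continuous).continuousOn
  have hmem : c ∈ Icc ((fun z => (Φ.symm z).im) u) ((fun z => (Φ.symm z).im) z₀) := ⟨hu.le, hz₀⟩
  obtain ⟨z, hz, hzc⟩ := hpc.intermediate_value (left_mem_segment ℝ u z₀) (right_mem_segment ℝ u z₀)
    hcont hmem
  exact ⟨z, hz, hzc⟩

/-- **Anchoring at arc `0`.** Let `Φ` be a square model of `R`, `0 < δ < ρ` with `ρ` a separation
constant of the low band (`exists_sep_low`). A discrete boundary vertex `x` of `Ω_δ` whose mesh
point lies in `Ω` with model coordinates in the low band, and which has a lattice neighbour `y`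
such that the drawn edge `[δx, δy]` reaches model height `≤ -1` while keeping model abscissa in
`[-1, 1]`, belongs to the discrete arc of arc `0`. -/
theorem mem_discreteArc_zero (h : IsSquareModel R Φ) {s ρ δ : ℝ}
    (hsep : ∀ z : ℂ, (Φ.symm z).re ∈ Icc (-1 + s / 2) (1 - s / 2) →
      (Φ.symm z).im ∈ Icc (-1 : ℝ) (-1 / 2) → ρ < infDist z (frontier R.carrier \ R.arc 0))
    (hδ : 0 < δ) (hδρ : δ < ρ) {x y : Site 2} (hxb : x ∈ meshBoundary R.carrier δ)
    (hxy : (zdGraph 2).Adj x y)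
    (hre : (Φ.symm (meshPoint δ x)).re ∈ Icc (-1 + s / 2) (1 - s / 2))
    (him : (Φ.symm (meshPoint δ x)).im ∈ Ioc (-1 : ℝ) (-1 / 2))
    (hlow : ∃ z₀ ∈ segment ℝ (meshPoint δ x) (meshPoint δ y), (Φ.symm z₀).im ≤ -1)
    (hband : ∀ z ∈ segment ℝ (meshPoint δ x) (meshPoint δ y), (Φ.symm z).re ∈ Icc (-1 : ℝ) 1) :
    x ∈ discreteArc R.carrier δ (R.arc 0) := by
  refine ⟨hxb, ?_⟩
  -- a point of arc `0` on the edge, within `δ` of `δx`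
  obtain ⟨z₀, hz₀, hz₀im⟩ := hlow
  obtain ⟨z₁, hz₁, hz₁im⟩ := exists_im_eq_of_le (Φ := Φ) him.1 hz₀im
  have hz₁seg : z₁ ∈ segment ℝ (meshPoint δ x) (meshPoint δ y) :=
    (convex_segment _ _).segment_subset (left_mem_segment ℝ _ _) hz₀ hz₁
  have hz₁arc : z₁ ∈ R.arc 0 := (SquareModelDict.mem_arc_zero_iff h).2 ⟨hz₁im, hband z₁ hz₁seg⟩
  have h1 : infDist (meshPoint δ x) (R.arc 0) ≤ δ :=
    (infDist_le_dist_of_mem hz₁arc).trans (dist_meshPoint_le_of_mem_segment hδ hxy hz₁seg)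
  -- the other arcs are farther than `ρ > δ`
  have h2 : ρ < infDist (meshPoint δ x) (frontier R.carrier \ R.arc 0) :=
    hsep _ hre ⟨him.1.le, him.2⟩
  linarith

/-- **Anchoring at arc `2`.** The symmetric statement for the high band and arc `2`. -/
theorem mem_discreteArc_two (h : IsSquareModel R Φ) {s ρ δ : ℝ}
    (hsep : ∀ z : ℂ, (Φ.symm z).re ∈ Icc (-1 + s / 2) (1 - s / 2) →
      (Φ.symm z).im ∈ Icc (1 / 2 : ℝ) 1 → ρ < infDist z (frontier R.carrier \ R.arc 2))
    (hδ : 0 < δ) (hδρ : δ < ρ) {x y : Site 2} (hxb : x ∈ meshBoundary R.carrier δ)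
    (hxy : (zdGraph 2).Adj x y)
    (hre : (Φ.symm (meshPoint δ x)).re ∈ Icc (-1 + s / 2) (1 - s / 2))
    (him : (Φ.symm (meshPoint δ x)).im ∈ Ico (1 / 2 : ℝ) 1)
    (hhigh : ∃ z₀ ∈ segment ℝ (meshPoint δ x) (meshPoint δ y), 1 ≤ (Φ.symm z₀).im)
    (hband : ∀ z ∈ segment ℝ (meshPoint δ x) (meshPoint δ y), (Φ.symm z).re ∈ Icc (-1 : ℝ) 1) :
    x ∈ discreteArc R.carrier δ (R.arc 2) := by
  refine ⟨hxb, ?_⟩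
  obtain ⟨z₀, hz₀, hz₀im⟩ := hhigh
  obtain ⟨z₁, hz₁, hz₁im⟩ := exists_im_eq_of_ge (Φ := Φ) him.2 hz₀im
  have hz₁seg : z₁ ∈ segment ℝ (meshPoint δ x) (meshPoint δ y) :=
    (convex_segment _ _).segment_subset (left_mem_segment ℝ _ _) hz₀ hz₁
  have hz₁arc : z₁ ∈ R.arc 2 := (SquareModelDict.mem_arc_two_iff h).2 ⟨hz₁im, hband z₁ hz₁seg⟩
  have h1 : infDist (meshPoint δ x) (R.arc 2) ≤ δ :=
    (infDist_le_dist_of_mem hz₁arc).trans (dist_meshPoint_le_of_mem_segment hδ hxy hz₁seg)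
  have h2 : ρ < infDist (meshPoint δ x) (frontier R.carrier \ R.arc 2) :=
    hsep _ hre ⟨him.1, him.2.le⟩
  linarith

end DiscreteArcs

/-- **Registered one-line form `stub_sandwichLowerGeometry`** (S1a-G) of `exists_sep_low`, so that
this helper file rides with the line. -/
theorem stub_sandwichLowerGeometry :
    ∀ (R : Literature.Probability.RandomPlanarGeometry.ConformalRectangle) (Φ : ℂ ≃ₜ ℂ),
      Literature.Probability.Percolation.IsSquareModel R Φ → ∀ (s : ℝ), 0 < s →
        ∃ ρ > (0 : ℝ), ∀ z : ℂ, (Φ.symm z).re ∈ Set.Icc (-1 + s / 2) (1 - s / 2) →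
          (Φ.symm z).im ∈ Set.Icc (-1 : ℝ) (-1 / 2) → ρ < Metric.infDist z (frontier R.carrier \ R.arc 0) :=
  fun _ _ h _ hs => exists_sep_low h hs

end Summit.CriticalPhenomena.CardyFormulaZ2.Theorems.ClusterSetConnected

end
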